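import Summits.Ventures.LatticeQCDFlow.Scaling.DominatedStarRegimeFreeLogSobolev

/-!
HONEST FRAMING: exact (Metropolis-corrected) sampling algorithms for lattice gauge theory; figures
of merit are autocorrelation/cost numbers at stated couplings and volumes; no continuum-physics
claim.

# DominatedStarLogSobolevMixing — THE LOG-SOBOLEV CONSTANT AND THE `log log`-MIXING TIME OF THE MAP-ASSISTED HOT-REFRESHED HUB, NO
# REGIME: `α(P) ≥ G'·α₀`, `α(PP̃) ≥ (1−t)w_0·G'·α₀` (`α₀ ≤` every level's exact-redraw constant, e.g.
# `min_k (1 − 2μ_{k,*})/log((1 − μ_{k,*})/μ_{k,*})`), HENCE **`t_mix(ε) ≤ ⌈(log log(1/π̃_min) + log(1/(2ε²)))/((1−t)w_0·G'·α₀)⌉`**,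
# `G' = p·min{ct/(3m), (1−t)w_0/(7K)}` — THE NUMBER OF LEVELS INSIDE A DOUBLE LOGARITHM (lean-2 GEN-28, ours)

Venture-side (OURS).  Cell `lqcd-flow` (pub-lqcd), unit `pub-lqcd-lean-2-g28`, 2026-08-28.  Chapter N, file 14: the assembly of
`Scaling/DominatedStarRegimeFreeLogSobolev` (N13: `𝓔_{Π*} ≤ 𝓔_P/((K+1)G')`, `α(PP̃) ≥ h·α(P)`) with the tree's Saloff-Coste Lemma 2.2.11
(log-Sobolev constant of a product), Lemma 2.2.12 (comparison), Corollary 2.2.10 (the exact-redraw chain) and Miclo's discrete-time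
bound `t_mix(ε) ≤ ⌈(log log(1/π_min) + log(1/(2ε²)))/α(PP̃)⌉`.

## What is proved

* `exactRedraw_logSobolevConst_ge` — `α(μ_k, E_k) ≥ (1 − 2μ_k(x_m))/log((1 − μ_k(x_m))/μ_k(x_m))` at a minimiser `x_m` of `μ_k`.
* **`dominatedStar_logSobolevConst_ge`** — `α(P) ≥ G'·α₀` (`α₀ ≤ α(μ_k, E_k)` for all `k`; exact hot sampler, one-sided domination,
  multiplicities `≥ c ≥ 1`, `0 < t < 1`, `w_0 > 0`, cold updates arbitrary transition matrices).
* **`dominatedStar_logSobolevConst_sq_ge`** — `α(PP̃) ≥ (1−t)w_0·G'·α₀` (reversible cold kernels).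
* **`dominatedStar_mixingTime_le_logSobolev`** — `0 < α₀`, `0 < π̃_min < 1`, `π̃_min ≤ π̃`, `ε > 0`:
  **`t_mix(ε) ≤ ⌈(log log(1/π̃_min) + log(1/(2ε²)))/((1−t)w_0·G'·α₀)⌉`**.

Reading (no numerics implied): against `Scaling/DominatedStarRegimeFreeRelaxation`'s `⌈G⁻¹·log(1/(2ε·π̃_min))⌉`, the volume
`log(1/π̃_min) = Σ_k log(1/min μ_k)` is replaced by `log log(1/π̃_min)/α₀ ≈ L_max·log(Σ_k L_k)` (`L_k = log(1/min μ_k)`): the number of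
levels costs a logarithm, one level's volume still costs linearly, and `(1−t)w_0` is paid once more for discrete time (a factor `2` at
hot-only half swaps).  NOT CLAIMED: removal of `L_max` (OPEN-MATH item 1 proper); anything measured.  Literature grade (cell rule): OWN
COMPOSITION; nothing cited as a fact; no new bib keys.
-/

noncomputable section

open Finset Function Matrix
open Literature.Probability.MarkovChains

namespace Summit.Ventures.LatticeQCDFlow.Scaling

variable {S : Type*} [Fintype S] [DecidableEq S] {K m : ℕ} {μ : Fin (K + 1) → S → ℝ} {M : Fin (K + 1) → S → S → ℝ}
  {w : Fin (K + 1) → ℝ} {t p : ℝ}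

/-- **The exact redraw from `μ_k` has log-Sobolev constant `≥ (1 − 2μ_{k,*})/log((1 − μ_{k,*})/μ_{k,*})`** (`x_m` a minimiser of
`μ_k`; Corollary 2.2.10 in the tree with `λ(E_k) = 1`). [ours] -/
theorem exactRedraw_logSobolevConst_ge [Nontrivial S] (hμ : ∀ k x, 0 < μ k x) (hμ1 : ∀ k, ∑ u, μ k u = 1) (k : Fin (K + 1))
    {xm : S} (hxm : ∀ u, μ k xm ≤ μ k u) :
    (1 - 2 * μ k xm) / Real.log ((1 - μ k xm) / μ k xm) ≤ logSobolevConst (μ k) (fun _ v : S => μ k v) := by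
  have e : (fun _ v : S => μ k v) = (limitMatrix (μ k) : Matrix S S ℝ) := by
    funext a b; simp [limitMatrix]
  have h := Saloffcoste1997_cor_2_2_10 (hμ k) (hμ1 k) hxm (K := limitMatrix (μ k))
    (fun a b => by simp only [limitMatrix, Matrix.of_apply]; exact (hμ k b).le)
  rw [spectralGapR_limitMatrix (hμ k) (hμ1 k), mul_one] at h
  rw [e]
  exact h

section EntryStar
variable (κ : Fin m → Fin K) (φ : Fin m → Equiv.Perm S)

/-- **`α(P) ≥ G'·α₀`** for the chapter-M scheme with entry maps (hot update of Poincaré constant `γ₀`; `G'·3m ≤ pct`,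
`G'(p + 6K) ≤ pγ₀(1−t)w_0`; `α₀ ≤ α(μ_k, E_k)` for every level; cold updates arbitrary; `|S| ≥ 2`). [ours] -/
theorem dominatedStar_logSobolevConst_ge [Nontrivial S] (hm : 1 ≤ m) (hμ : ∀ k x, 0 < μ k x) (hμ1 : ∀ k, ∑ u, μ k u = 1)
    (hM : ∀ k, IsRowStochastic (M k)) {γ₀ : ℝ} (hγ₀ : 0 < γ₀)
    (hgap0 : ∀ h : S → ℝ, γ₀ * lawVariance (μ 0) h ≤ dirichletForm (μ 0) (M 0) h) (hw0 : ∀ k, 0 ≤ w k) (hwhot : 0 < w 0)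
    (ht0 : 0 < t) (ht1 : t < 1) (hp : 0 < p) (hdom : ∀ (r : Fin m) (u : S), p * μ (κ r).succ (φ r u) ≤ μ 0 u)
    {c : ℕ} (hc1 : 1 ≤ c) (hc : ∀ k : Fin K, c ≤ (univ.filter (fun r : Fin m => κ r = k)).card)
    {G : ℝ} (hG0 : 0 < G) (hG1 : G * (3 * m) ≤ p * c * t) (hG2 : G * (p + 6 * K) ≤ p * γ₀ * (1 - t) * w 0)
    {α₀ : ℝ} (hα : ∀ k, α₀ ≤ logSobolevConst (μ k) (fun _ v : S => μ k v)) :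
    G * α₀ ≤ logSobolevConst (tensorFun μ) (fun y z : Fin (K + 1) → S =>
        t * ptGraphSwap μ (fun r : Fin m => (((0 : Fin (K + 1)), (κ r).succ) : Fin (K + 1) × Fin (K + 1))) φ y z
          + (1 - t) * prodKernel w M y z) := by
  have hKpos : (0 : ℝ) < K + 1 := by positivity
  -- the product of exact redraws and its log-Sobolev constant
  set E : Fin (K + 1) → S → S → ℝ := fun k _ v => μ k v with hE
  set ω : Fin (K + 1) → ℝ := fun _ => (1 : ℝ) / (K + 1) with hω
  have hErow : ∀ k, IsRowStochastic (E k) := fun k => ⟨fun _ v => (hμ k v).le, fun _ => hμ1 k⟩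
  have hω0 : ∀ k, 0 ≤ ω k := fun k => by positivity
  have hω1 : ∑ k, ω k = 1 := by
    rw [hω, sum_const, card_univ, Fintype.card_fin, nsmul_eq_mul]
    push_cast
    field_simp
  have hprod : logSobolevConst (tensorFun μ) (prodKernel ω E) = univ.inf' univ_nonempty (fun j => ω j * logSobolevConst (μ j) (E j)) :=
    Saloffcoste1997_lemma_2_2_11_alpha hω0 hω1 hErow hμ hμ1
  have hprod_ge : 1 / (K + 1) * α₀ ≤ logSobolevConst (tensorFun μ) (prodKernel ω E) := by
    rw [hprod]
    refine Finset.le_inf' _ _ fun j _ => ?_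
    exact mul_le_mul_of_nonneg_left (hα j) (by positivity)
  -- comparison `𝓔_{Π*} ≤ 𝓔_P/((K+1)G)`
  have hcomp := Saloffcoste1997_lemma_2_2_12_logSobolev_same (tensorFun_pos hμ) (sum_tensorFun_eq_one μ hμ1) (tensorFun_pos hμ)
    (sum_tensorFun_eq_one μ hμ1)
    (fun y z : Fin (K + 1) → S =>
        t * ptGraphSwap μ (fun r : Fin m => (((0 : Fin (K + 1)), (κ r).succ) : Fin (K + 1) × Fin (K + 1))) φ y z
          + (1 - t) * prodKernel w M y z)
    (K' := prodKernel ω E) (prodKernel_isRowStochastic E ω hω0 hω1 hErow).1 (A := 1 / ((K + 1) * G)) (a := 1) (by positivity)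
    zero_le_one (fun f => dominatedStar_exactProduct_dirichletForm_le κ φ hm hμ hμ1 hM hγ₀ hgap0 hw0 hwhot ht0 ht1 hp hdom hc1 hc hG0
      hG1 hG2 f) (fun x => by rw [one_mul])
  -- `1 · α(Π*) / (1/((K+1)G)) ≤ α(P)`, i.e. `(K+1)G·α(Π*) ≤ α(P)`
  rw [one_mul, div_div_eq_mul_div, div_one] at hcomp
  calc G * α₀ = (1 / (K + 1) * α₀) * ((K + 1) * G) := by field_simp
    _ ≤ logSobolevConst (tensorFun μ) (prodKernel ω E) * ((K + 1) * G) :=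
        mul_le_mul_of_nonneg_right hprod_ge (by positivity)
    _ ≤ _ := hcomp

/-- **`α(PP̃) ≥ (1−t)w_0·G'·α₀`** (reversible cold kernels; otherwise as above). [ours] -/
theorem dominatedStar_logSobolevConst_sq_ge [Nontrivial S] (hm : 1 ≤ m) (hμ : ∀ k x, 0 < μ k x) (hμ1 : ∀ k, ∑ u, μ k u = 1)
    (hM : ∀ k, IsRowStochastic (M k)) (hMrev : ∀ k, DetailedBalance (μ k) (M k)) (hM0 : ∀ u v, M 0 u v = μ 0 v)
    (hw0 : ∀ k, 0 ≤ w k) (hw1 : ∑ k, w k = 1) (hwhot : 0 < w 0) (ht0 : 0 < t) (ht1 : t < 1) (hp : 0 < p)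
    (hdom : ∀ (r : Fin m) (u : S), p * μ (κ r).succ (φ r u) ≤ μ 0 u)
    {c : ℕ} (hc1 : 1 ≤ c) (hc : ∀ k : Fin K, c ≤ (univ.filter (fun r : Fin m => κ r = k)).card)
    {G : ℝ} (hG0 : 0 < G) (hG1 : G * (3 * m) ≤ p * c * t) (hG2 : G * (p + 6 * K) ≤ p * 1 * (1 - t) * w 0)
    {α₀ : ℝ} (hα : ∀ k, α₀ ≤ logSobolevConst (μ k) (fun _ v : S => μ k v)) :
    (1 - t) * w 0 * (G * α₀) ≤ logSobolevConst (tensorFun μ) (mulReversibilization (tensorFun μ)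
        (fun y z : Fin (K + 1) → S =>
          t * ptGraphSwap μ (fun r : Fin m => (((0 : Fin (K + 1)), (κ r).succ) : Fin (K + 1) × Fin (K + 1))) φ y z
            + (1 - t) * prodKernel w M y z)) := by
  have h1t : 0 < 1 - t := by linarith
  have hh : 0 < (1 - t) * w 0 := mul_pos h1t hwhot
  have hsq := logSobolevConst_sq_ge (P := fun y z : Fin (K + 1) → S =>
      t * ptGraphSwap μ (fun r : Fin m => (((0 : Fin (K + 1)), (κ r).succ) : Fin (K + 1) × Fin (K + 1))) φ y z
        + (1 - t) * prodKernel w M y z) (tensorFun_pos hμ) (sum_tensorFun_eq_one μ hμ1)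
    (weightedScheme_isRowStochastic (ptGraphSwap_isRowStochastic hμ) hM hw0 hw1 ht0.le ht1.le)
    (weightedScheme_detailedBalance (ptGraphSwap_detailedBalance hμ) hMrev t) hh
    (fun f => dominatedStar_dirichletForm_le (ptGraphSwap_isRowStochastic hμ) (ptGraphSwap_detailedBalance hμ) ht0.le ht1.le
      hw0 hw1 hμ hμ1 hM hMrev hM0 f)
  have hα := dominatedStar_logSobolevConst_ge κ φ hm hμ hμ1 hM one_pos (exactSampler_poincare_one (hμ1 0) hM0) hw0 hwhot ht0 ht1 hp
    hdom hc1 hc hG0 hG1 hG2 hα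
  exact (mul_le_mul_of_nonneg_left hα hh.le).trans hsq

/-- **THE `log log` MIXING TIME OF THE MAP-ASSISTED HUB, NO REGIME:**
`t_mix(ε) ≤ ⌈(log log(1/π̃_min) + log(1/(2ε²)))/((1−t)w_0·G'·α₀)⌉` (exact hot sampler, one-sided domination, reversible cold kernels,
multiplicities `≥ c ≥ 1`, `0 < t < 1`, `w_0 > 0`, `|S| ≥ 2`; `G'·3m ≤ pct`, `G'(p + 6K) ≤ p(1−t)w_0`, `0 < G'`; `0 < α₀ ≤ α(μ_k, E_k)`;
`0 < π̃_min < 1`, `π̃_min ≤ π̃`). [ours] -/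
theorem dominatedStar_mixingTime_le_logSobolev [Nontrivial S] (hm : 1 ≤ m) (hμ : ∀ k x, 0 < μ k x) (hμ1 : ∀ k, ∑ u, μ k u = 1)
    (hM : ∀ k, IsRowStochastic (M k)) (hMrev : ∀ k, DetailedBalance (μ k) (M k)) (hM0 : ∀ u v, M 0 u v = μ 0 v)
    (hw0 : ∀ k, 0 ≤ w k) (hw1 : ∑ k, w k = 1) (hwhot : 0 < w 0) (ht0 : 0 < t) (ht1 : t < 1) (hp : 0 < p)
    (hdom : ∀ (r : Fin m) (u : S), p * μ (κ r).succ (φ r u) ≤ μ 0 u)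
    {c : ℕ} (hc1 : 1 ≤ c) (hc : ∀ k : Fin K, c ≤ (univ.filter (fun r : Fin m => κ r = k)).card)
    {G : ℝ} (hG0 : 0 < G) (hG1 : G * (3 * m) ≤ p * c * t) (hG2 : G * (p + 6 * K) ≤ p * 1 * (1 - t) * w 0)
    {α₀ : ℝ} (hα0 : 0 < α₀) (hα : ∀ k, α₀ ≤ logSobolevConst (μ k) (fun _ v : S => μ k v))
    {πmin : ℝ} (hmin0 : 0 < πmin) (hmin1 : πmin < 1) (hmin : ∀ x, πmin ≤ tensorFun μ x) {ε : ℝ} (hε : 0 < ε) :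
    mixingTime (fun y z : Fin (K + 1) → S =>
        t * ptGraphSwap μ (fun r : Fin m => (((0 : Fin (K + 1)), (κ r).succ) : Fin (K + 1) × Fin (K + 1))) φ y z
          + (1 - t) * prodKernel w M y z) (tensorFun μ) ε
      ≤ ⌈(Real.log (Real.log (1 / πmin)) + Real.log (1 / (2 * ε ^ 2))) / ((1 - t) * w 0 * (G * α₀))⌉₊ := by
  have h1t : 0 < 1 - t := by linarith
  set αP : ℝ := logSobolevConst (tensorFun μ) (mulReversibilization (tensorFun μ)
    (fun y z : Fin (K + 1) → S =>
      t * ptGraphSwap μ (fun r : Fin m => (((0 : Fin (K + 1)), (κ r).succ) : Fin (K + 1) × Fin (K + 1))) φ y z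
        + (1 - t) * prodKernel w M y z)) with hαP
  have hlow : (1 - t) * w 0 * (G * α₀) ≤ αP :=
    dominatedStar_logSobolevConst_sq_ge κ φ hm hμ hμ1 hM hMrev hM0 hw0 hw1 hwhot ht0 ht1 hp hdom hc1 hc hG0 hG1 hG2 hα
  have hden : 0 < (1 - t) * w 0 * (G * α₀) := mul_pos (mul_pos h1t hwhot) (mul_pos hG0 hα0)
  have hαpos : 0 < αP := lt_of_lt_of_le hden hlow
  have hP := weightedScheme_isRowStochastic (t := t) (w := w)
    (ptGraphSwap_isRowStochastic (e := fun r : Fin m => (((0 : Fin (K + 1)), (κ r).succ) : Fin (K + 1) × Fin (K + 1)))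
      (φ := φ) hμ) hM hw0 hw1 ht0.le ht1.le
  have hDB := weightedScheme_detailedBalance (w := w)
    (ptGraphSwap_detailedBalance (e := fun r : Fin m => (((0 : Fin (K + 1)), (κ r).succ) : Fin (K + 1) × Fin (K + 1)))
      (φ := φ) hμ) hMrev t
  have hT := Miclo1997_mixingTime_le (tensorFun_pos hμ) (sum_tensorFun_eq_one μ hμ1) hP (hDB.isStationary hP.2) hαpos hmin0
    hmin1 hmin hε
  set N : ℝ := Real.log (Real.log (1 / πmin)) + Real.log (1 / (2 * ε ^ 2)) with hN
  by_cases hN0 : 0 ≤ N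
  · exact hT.trans (Nat.ceil_mono (div_le_div_of_nonneg_left hN0 hden hlow))
  · push Not at hN0
    -- a negative numerator: Miclo's ceiling is already `0`
    have hz : ⌈N / αP⌉₊ = 0 := Nat.ceil_eq_zero.mpr (div_nonpos_iff.mpr (Or.inr ⟨hN0.le, hαpos.le⟩))
    rw [hz] at hT
    exact hT.trans (Nat.zero_le _)

end EntryStar

end Summit.Ventures.LatticeQCDFlow.Scaling

end
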